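import Literature.Combinatorics.StablePolynomials.GraceWalshSzegoDisk
import HarnessLib

/-!
# Symmetrization preserves `𝔻`-stability (Borcea–Brändén II, Theorem 1.2 (a) and Proposition 1.3 (a) for
# `C` an open disk)

J. Borcea, P. Brändén, *The Lee–Yang and Pólya–Schur programs. II.*, Comm. Pure Appl. Math. 62 (2009)
1595–1631 (arXiv:0809.3087), §1:

> **Theorem 1.2.** Let `C` be an open or closed circular domain. (a) If `C` is convex then the
> symmetrization operator `Sym` preserves `C`-stability on multi-affine polynomials, i.e.,
> `Sym : ℂ_{(1ⁿ)}[z_1,…,z_n] → ℂ_{(1ⁿ)}[z_1,…,z_n]` preserves `C`-stability.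
>
> **Proposition 1.3.** Let `f ∈ ℂ_{(1ⁿ)}[z_1,…,z_n]`, `C` be an open or closed circular domain, `0 ≤ p ≤ 1`,
> and `τ = (ij) ∈ 𝔖_n` be a transposition. (a) If `C` is convex and `f` is `C`-stable then so is
> `pf + (1-p)τ(f)`.

and their proof in §1: "for `n ∈ ℕ` and `C`, `Φ_κ` as in Lemma 1.8 with `κ = (1,…,1)`, the partial
symmetrization operator commutes with `Φ_κ` … Hence by Lemma 1.8 it suffices to prove [them] for `H`".

The tree has both statements for `C = H` (`IsUpperHalfPlaneStable.symmetrization`, `Symmetrization.lean`;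
`IsUpperHalfPlaneStable.partialSymmetrization`, `PartialSymmetrization.lean`). This file performs the printed
transport to the open unit disk `𝔻` along the Möbius substitution `Φ_{(1ⁿ)}` of `DiskStabilityPreservers.lean`
(`Ψ = mobiusSubst (1ⁿ) 1 (-i) (-i) 1`, Lemma 6.2 of part I as the equivalence
`isDiskStable_iff_isUpperHalfPlaneStable_mobiusSubst`), and then to an arbitrary open disk by the affine
substitution `z ↦ rz + c` (`affineSubst`).

-- TODO(general form): closed disks and the non-convex circular domains (parts (b)).

## Contents

* `isDiskStable_of_isUpperHalfPlaneStable_mobiusSubst`, `isDiskStable_iff_isUpperHalfPlaneStable_mobiusSubst`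
  (part I Lemma 6.2 for `𝔻ⁿ` as an equivalence).
* `symmetrization_mobiusSubst`, `symmetrization_affineSubst` (`Sym` commutes with `Φ_{(kⁿ)}` and with affine
  substitutions).
* **`IsDiskStable.symmetrization`** (Thm 1.2 (a), `C = 𝔻`), `IsDiskStable.symmetrization_ne_zero`,
  **`IsDiskStable.partialSymmetrization`** (Prop 1.3 (a), `C = 𝔻`),
  **`symmetrization_ne_zero_of_mem_ball`**, **`partialSymmetrization_ne_zero_of_mem_ball`** (any open disk).

## References

* [BorceaBranden2009II] J. Borcea, P. Brändén, Comm. Pure Appl. Math. 62 (2009) 1595–1631, §1 Thm 1.2 (a),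
  Prop 1.3 (a), Lemma 1.8 and the reduction after it.
* [BorceaBranden2009] J. Borcea, P. Brändén, Invent. Math. 177 (2009) 541–569, §6.1 Lemma 6.2.
-/

noncomputable section

open MvPolynomial Finset

open Complex (I)

namespace Literature.Combinatorics.StablePolynomials

variable {σ : Type*} [Fintype σ] [DecidableEq σ]

/-! ## §1 Lemma 6.2 for `𝔻ⁿ` as an equivalence -/

section Transport

/-- **`g ∈ ℂ_κ[z]` is `𝔻`-stable as soon as `Ψ_κ(g)` is stable** (apply `Φ_κ`: `Φ_κ Ψ_κ g = 2^{|κ|} g`).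
[cite: BorceaBranden2009, §6.1 Lemma 6.2 (bijection)] -/
theorem isDiskStable_of_isUpperHalfPlaneStable_mobiusSubst (κ : σ → ℕ) {g : MvPolynomial σ ℂ}
    (hκ : ∀ i, degreeOf i g ≤ κ i) (h : IsUpperHalfPlaneStable (mobiusSubst κ 1 (-I) (-I) 1 g)) :
    IsDiskStable g := by
  have h2 := h.isDiskStable_mobiusSubst κ (degreeOf_mobiusSubst_le κ 1 (-I) (-I) 1 hκ)
  rwa [mobiusSubst_phi_psi κ hκ, isDiskStable_smul_iff (pow_ne_zero _ two_ne_zero)] at h2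

/-- **Lemma 6.2 (`𝔻ⁿ ↔ Hⁿ`) as an equivalence**: `g ∈ ℂ_κ[z]` is `𝔻`-stable iff
`Ψ_κ(g)(ζ) = Π(-iζ_j+1)^{κ_j} g(ψ(ζ))` is stable. [cite: BorceaBranden2009, §6.1 Lemma 6.2]
[cite: BorceaBranden2009II, §1 Lemma 1.8] -/
theorem isDiskStable_iff_isUpperHalfPlaneStable_mobiusSubst (κ : σ → ℕ) {g : MvPolynomial σ ℂ}
    (hκ : ∀ i, degreeOf i g ≤ κ i) :
    IsDiskStable g ↔ IsUpperHalfPlaneStable (mobiusSubst κ 1 (-I) (-I) 1 g) :=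
  ⟨fun h => h.isUpperHalfPlaneStable_mobiusSubst κ hκ, isDiskStable_of_isUpperHalfPlaneStable_mobiusSubst κ hκ⟩

/-- **`Sym` commutes with `Φ_{(kⁿ)}`** ("the partial symmetrization operator commutes with the operator
`Φ_κ`"). [cite: BorceaBranden2009II, §1 proof of Prop. 1.3 (after Lemma 1.8)] -/
theorem symmetrization_mobiusSubst (k : ℕ) (a b c d : ℂ) (f : MvPolynomial σ ℂ) :
    symmetrization (mobiusSubst (fun _ : σ => k) a b c d f) =
      mobiusSubst (fun _ : σ => k) a b c d (symmetrization f) := by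
  rw [symmetrization_apply, symmetrization_apply, map_smul, map_sum]
  congr 1
  exact sum_congr rfl fun e _ => rename_equiv_mobiusSubst k a b c d e f

/-- **`Sym` commutes with the affine substitutions `z ↦ az + b`** (the maps `Φ_{(1ⁿ)}` of Lemma 1.8 for
affine Möbius maps). [cite: BorceaBranden2009II, §1 proof of Prop. 1.3 (after Lemma 1.8)] -/
theorem symmetrization_affineSubst (a b : ℂ) (f : MvPolynomial σ ℂ) :
    symmetrization (affineSubst a b f) = affineSubst a b (symmetrization f) := by
  rw [symmetrization_apply, symmetrization_apply, map_smul, map_sum]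
  congr 1
  exact sum_congr rfl fun e _ => rename_perm_affineSubst e a b f

end Transport

/-! ## §2 Theorem 1.2 (a) and Proposition 1.3 (a) for `C = 𝔻` -/

section Disk

/-- **Borcea–Brändén II, Theorem 1.2 (a) for `C = 𝔻`**: `Sym` preserves `𝔻`-stability on multi-affine
polynomials. Proof as printed: `Ψ(f)` is stable and multi-affine, `Sym Ψ(f) = Ψ(Sym f)` is stable (the case
`C = H`), hence `Sym f` is `𝔻`-stable. [cite: BorceaBranden2009II, §1 Thm. 1.2 (a) (`C = 𝔻`) and its reduction
to `H` after Lemma 1.8] -/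
theorem IsDiskStable.symmetrization {f : MvPolynomial σ ℂ} (hf : IsMultiAffine f) (hs : IsDiskStable f) :
    IsDiskStable (StablePolynomials.symmetrization f) := by
  have hf1 : ∀ i, degreeOf i f ≤ (fun _ : σ => 1) i := hf
  have hG := (hs.isUpperHalfPlaneStable_mobiusSubst (fun _ : σ => 1) hf1).symmetrization
    (hf.mobiusSubst 1 (-I) (-I) 1)
  rw [symmetrization_mobiusSubst] at hG
  exact isDiskStable_of_isUpperHalfPlaneStable_mobiusSubst (fun _ : σ => 1) hf.symmetrization hG

/-- `Sym` of a `𝔻`-stable multi-affine polynomial is nonzero. [cite: BorceaBranden2009II, §1 Thm. 1.2 (a)] -/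
theorem IsDiskStable.symmetrization_ne_zero {f : MvPolynomial σ ℂ} (hf : IsMultiAffine f) (hs : IsDiskStable f) :
    StablePolynomials.symmetrization f ≠ 0 := fun h =>
  hs.symmetrization hf (fun _ => 0) (fun _ => by simp) (by rw [h, map_zero])

/-- **Borcea–Brändén II, Proposition 1.3 (a) for `C = 𝔻`**: for a `𝔻`-stable multi-affine `f`, a
transposition `τ = (a b)` and `0 ≤ θ ≤ 1`, `θ f + (1-θ) τ(f)` is `𝔻`-stable. [cite: BorceaBranden2009II, §1
Prop. 1.3 (a) (`C = 𝔻`) and its reduction to `H` after Lemma 1.8] -/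
theorem IsDiskStable.partialSymmetrization {f : MvPolynomial σ ℂ} (hf : IsMultiAffine f) (hs : IsDiskStable f)
    (a b : σ) {θ : ℝ} (h0 : 0 ≤ θ) (h1 : θ ≤ 1) :
    IsDiskStable ((θ : ℂ) • f + (1 - (θ : ℂ)) • MvPolynomial.rename (Equiv.swap a b) f) := by
  have hf1 : ∀ i, degreeOf i f ≤ (fun _ : σ => 1) i := hf
  have hG := (hs.isUpperHalfPlaneStable_mobiusSubst (fun _ : σ => 1) hf1).partialSymmetrization
    (hf.mobiusSubst 1 (-I) (-I) 1) a b h0 h1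
  have hlin : (θ : ℂ) • mobiusSubst (fun _ : σ => 1) 1 (-I) (-I) 1 f +
      (1 - (θ : ℂ)) • MvPolynomial.rename (Equiv.swap a b) (mobiusSubst (fun _ : σ => 1) 1 (-I) (-I) 1 f) =
      mobiusSubst (fun _ : σ => 1) 1 (-I) (-I) 1 ((θ : ℂ) • f + (1 - (θ : ℂ)) • MvPolynomial.rename (Equiv.swap a b) f) := by
    rw [map_add, map_smul, map_smul, rename_equiv_mobiusSubst]
  rw [hlin] at hG
  exact isDiskStable_of_isUpperHalfPlaneStable_mobiusSubst (fun _ : σ => 1)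
    ((hf.smul _).add ((hf.rename_equiv (Equiv.swap a b)).smul _)) hG

end Disk

/-! ## §3 Arbitrary open disks -/

section Ball

omit [Fintype σ] [DecidableEq σ] in
/-- The pull-back `F(u) = f(ru + c)` of a polynomial non-vanishing on the polydisk `{|z_i - c| < r}ⁿ` is
`𝔻`-stable. [cite: BorceaBranden2009II, §1 Lemma 1.8 (affine `Φ_κ`)] -/
theorem isDiskStable_affineSubst {f : MvPolynomial σ ℂ} (c : ℂ) {r : ℝ} (hr : 0 < r)
    (hs : ∀ z : σ → ℂ, (∀ i, ‖z i - c‖ < r) → eval z f ≠ 0) : IsDiskStable (affineSubst r c f) := by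
  intro u hu
  rw [eval_affineSubst]
  refine hs _ fun i => ?_
  rw [add_sub_cancel_right, norm_mul, Complex.norm_real, Real.norm_of_nonneg hr.le]
  calc r * ‖u i‖ < r * 1 := mul_lt_mul_of_pos_left (hu i) hr
    _ = r := mul_one r

omit [Fintype σ] [DecidableEq σ] in
/-- From the pull-back back to the disk `{|z - c| < r}`. [cite: BorceaBranden2009II, §1 Lemma 1.8] -/
theorem eval_ne_zero_of_isDiskStable_affineSubst {g : MvPolynomial σ ℂ} (c : ℂ) {r : ℝ} (hr : 0 < r)
    (hg : IsDiskStable (affineSubst r c g)) (z : σ → ℂ) (hz : ∀ i, ‖z i - c‖ < r) : eval z g ≠ 0 := by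
  have hr0 : (r : ℂ) ≠ 0 := Complex.ofReal_ne_zero.2 hr.ne'
  have h := hg (fun i => (z i - c) / r) fun i => by
    rw [norm_div, Complex.norm_real, Real.norm_of_nonneg hr.le, div_lt_one hr]
    exact hz i
  rw [eval_affineSubst] at h
  have hz' : (fun i => (r : ℂ) * ((z i - c) / r) + c) = z := funext fun i => by
    field_simp
    ring
  rwa [hz'] at h

/-- **Theorem 1.2 (a) for an arbitrary open disk `C = {|z - c| < r}`**: if the multi-affine `f` does not vanish
on `Cⁿ` then neither does `Sym f`. [cite: BorceaBranden2009II, §1 Thm. 1.2 (a) (`C` an open disk)] -/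
theorem symmetrization_ne_zero_of_mem_ball {f : MvPolynomial σ ℂ} (hf : IsMultiAffine f) (c : ℂ) {r : ℝ}
    (hr : 0 < r) (hs : ∀ z : σ → ℂ, (∀ i, ‖z i - c‖ < r) → eval z f ≠ 0) (z : σ → ℂ)
    (hz : ∀ i, ‖z i - c‖ < r) : eval z (StablePolynomials.symmetrization f) ≠ 0 := by
  have hF := (isDiskStable_affineSubst c hr hs).symmetrization (hf.affineSubst r c)
  rw [symmetrization_affineSubst] at hF
  exact eval_ne_zero_of_isDiskStable_affineSubst c hr hF z hz

/-- **Proposition 1.3 (a) for an arbitrary open disk `C = {|z - c| < r}`.**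
[cite: BorceaBranden2009II, §1 Prop. 1.3 (a) (`C` an open disk)] -/
theorem partialSymmetrization_ne_zero_of_mem_ball {f : MvPolynomial σ ℂ} (hf : IsMultiAffine f) (c : ℂ)
    {r : ℝ} (hr : 0 < r) (hs : ∀ z : σ → ℂ, (∀ i, ‖z i - c‖ < r) → eval z f ≠ 0) (a b : σ) {θ : ℝ}
    (h0 : 0 ≤ θ) (h1 : θ ≤ 1) (z : σ → ℂ) (hz : ∀ i, ‖z i - c‖ < r) :
    eval z ((θ : ℂ) • f + (1 - (θ : ℂ)) • MvPolynomial.rename (Equiv.swap a b) f) ≠ 0 := by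
  have hF := (isDiskStable_affineSubst c hr hs).partialSymmetrization (hf.affineSubst r c) a b h0 h1
  have hlin : (θ : ℂ) • affineSubst r c f + (1 - (θ : ℂ)) • MvPolynomial.rename (Equiv.swap a b) (affineSubst r c f) =
      affineSubst r c ((θ : ℂ) • f + (1 - (θ : ℂ)) • MvPolynomial.rename (Equiv.swap a b) f) := by
    rw [map_add, map_smul, map_smul, rename_perm_affineSubst]
  rw [hlin] at hF
  exact eval_ne_zero_of_isDiskStable_affineSubst c hr hF z hz

end Ball

end Literature.Combinatorics.StablePolynomials

end
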